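import Summits.QuantumFields.YangMills.Theorems.BalabanUVNodesN12ClassLetterGeometryOfRecord
import HarnessLib

/-!
# BalabanUVNodes ∕ N12 — [Balaban1985Variational] THEOREM 1, EXISTENCE HALF, IN THE CLOSED-CLASS READING AT THE RECORD's `𝐁_k(Z)`:
# a (2.12) minimiser EXISTS over the closure of NODE 00's class for every datum with a non-empty fibre — the direct method, modulo numerics
# ([Balaban1985Variational] Thm 1 p. 279 «there exists a minimal orbit», (2), (6)–(7) pp. 278–279; [Balaban1988Convergent] (2.10)–(2.13) pp. 256–257; [Balaban1985Averaging] Prop. 2 p. 26)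

Cell `pub-ymgap` (HUMAN RULINGS D-0062 ∕ D-0149), WIDTH SEAT `pub-ymgap-dag-n12-w1` g4 (node N12 = [B15]; key K1⁹ `stmt-QuantumFields-27364`, `--kind proof --supports … --as helper`;
count-neutral).  THEOREMS ONLY (0 `def`, 0 `instance`, 0 `sorry`); consumed BY NAME: dag-n07-e's geometry-free direct method
`…N07AveragingLocalContinuity.exists_isMinimizer_of_isClosed_of_continuousOn` (module 16: «with holes the continuity hypothesis is fed bond by bond from the brick») and Part 3 of this
seat's class-letter discharge (`…N12ClassLetterGeometryOfRecord.continuousOn_constrainedAverages_closure_regMSCoPOfRecord_Bj`).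

WHY.  NODE 00's (2.12) class `regMSCoPOfRecord` is print's STRICT class (2) («(2) are strict upper bounds») — not closed — so compactness alone does not produce a minimiser in it; print's
Theorem 1 obtains the minimal orbit in the INTERIOR (8) by the contraction argument of Sects. F–G.  What compactness DOES give, once the constrained averages are known to be continuous on
the closed class (they are not continuous everywhere: the averaging of record is extended by `1` off the (0.4) guard), is a minimiser over the CLOSURE of the class — the closed-class
reading of Theorem 1's existence clause.  Parts 1–3 supply exactly that continuity at the record's `𝐁_k(Z)` ∕ maximal sequence, modulo numerics; THIS FILE takes the one remaining step.
(The strict-class minimiser — NODE 00's `UminOfRecord` on the solvable set — additionally needs the interior regularity (8) of closed-class minimisers: K0⁷'s row, not touched here.)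

CONTENTS.  ★ `continuousOn_iter_apply_closure_regMSCoPOfRecord_Bj` (per constrained bond, `SU(N)`-valued, from Part 3's matrix-valued family via the enumeration `constrEnum` and the
embedding `SU(N) ↪ M_N(ℂ)`), ★★★ `exists_isMinimizer_closure_regMSCoPOfRecord_Bj` (THE EXISTENCE: for every multi-scale datum `W` whose (2.10) fibre meets the closure of the class,
`∃ U₀, IsMinimizer (avOfRecord F N K) (closure (regMSCoPOfRecord F N ν K kc (maxDomT ν.M₁ Z))) (Bj ν.M₁ Z k) W U₀`, modulo `0 < εreg`, `C₀(d)·2L²εreg ≤ ⅓`, `2·2L²εreg ≤ c′₂`,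
`(d+14)·L ≤ M₁`, `M₁L^k ∣ N₀`, `k ≤ kc + 1`, `k ≤ m + K`).

HONEST FRAMING.  The CLOSED-class reading only; nothing about the interior (8), uniqueness, or the strict class; nothing of Bałaban's estimates asserted; N12 NOT discharged; K1⁹ ∕ K0⁷ NOT
closed; counts unmoved; one finite 𝕋⁴ programme at fixed ε — R4 closes the conditional rung `BalabanLadder.UV` only; the Yang–Mills mass gap (Clay) is NOT proved by any of this; nothing
continuum ∕ ℝ⁴ ∕ OS.
-/

noncomputable section

namespace Summit.QuantumFields.YangMills.BalabanUVNodes.N12MinimiserExistsClosedClassBj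

open Set Filter Topology
open Literature.MathematicalPhysics.QuantumFieldTheory.Balaban1983to89
open Literature.MathematicalPhysics.QuantumFieldTheory.Balaban1983to89.T4Continuum (T4Family)
open Literature.MathematicalPhysics.QuantumFieldTheory.Balaban1983to89.Node00
open Literature.MathematicalPhysics.QuantumFieldTheory.Balaban1983to89.Node00 (ConstrSet constrCard constrEnum)
open Literature.MathematicalPhysics.QuantumFieldTheory.Balaban1983to89.ExpMeanLog (deltaSU)
open Literature.MathematicalPhysics.QuantumFieldTheory.Balaban1983to89.B15DeterminingSets (DetSet MSField AgreeOn avgFamily bondsOf IsMinimizer)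
open B14.Eq213DetSet (Bj maxDomT Bj_of_gt)
open B14.Eq213MaximalDomains (side)
open Summit.QuantumFields.YangMills.BalabanUVNodes.N07AveragingLocalContinuity (exists_isMinimizer_of_isClosed_of_continuousOn)
open Summit.QuantumFields.YangMills.BalabanUVNodes.N12ClassLetterGeometryOfRecord (continuousOn_constrainedAverages_closure_regMSCoPOfRecord_Bj)
open scoped Matrix.Norms.L2Operator

variable {F : T4Family} {N : ℕ} [NeZero N] {K : ℕ}

/-- ★ **PER CONSTRAINED BOND, `SU(N)`-VALUED**: under Part 3's numerics, `U ↦ Ū^j(U)(c)` is continuous ON the closure of NODE 00's class for every constrained bond `(j, c)` of `𝐁_k(Z)` —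
the component `constrEnum 𝐁 k ⟨j, c⟩` of Part 3's matrix-valued family, pulled back along the embedding `SU(N) ↪ M_N(ℂ)`.
[cite: Balaban1985Variational, (2), (7) pp.278–279, (16)–(18) p.280; Balaban1988Convergent, (2.10)–(2.13) pp.256–257; Balaban1985Averaging, Prop. 2 p.26] -/
theorem continuousOn_iter_apply_closure_regMSCoPOfRecord_Bj (ν : Stage7Numerics) (hε : 0 < ν.εreg) {k : ℕ} (hk : k ≤ (F.P K).m + (F.P K).K)
    (hdiv : side (F.P K).L ν.M₁ k ∣ (F.P K).sitesPerDir 0) (hfloor : ((F.P K).d + 14) * (F.P K).L ≤ ν.M₁) (Z : Set (Site (F.P K) 0))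
    (kc : ℕ) (hkc : k ≤ kc + 1)
    (hα3 : (143 * (((((F.P K).d + 4 : ℕ) : ℝ)) ^ 2 / 4) ^ 2) * (2 * ((F.P K).L : ℝ) ^ 2 * ν.εreg) ≤ 1 / 3)
    (hα2 : 2 * (2 * ((F.P K).L : ℝ) ^ 2 * ν.εreg) ≤ 2 * deltaSU (Fin N) / ((((F.P K).d + 4) * (F.P K).L : ℕ) : ℝ) ^ 2)
    {j : ℕ} (hj : j ≤ k) {c : PBond (F.P K) j} (hc : c ∈ bondsOf (Bj ν.M₁ Z k j)) :
    ContinuousOn (fun U : GaugeField (F.P K) 0 (SU N) => Averaging.iter (avOfRecord F N K) j U c)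
      (closure (regMSCoPOfRecord F N ν K kc (maxDomT ν.M₁ Z))) := by
  have h := continuousOn_constrainedAverages_closure_regMSCoPOfRecord_Bj (N := N) ν hε hk hdiv hfloor Z kc hkc hα3 hα2
  have hi := (continuousOn_pi.1 h) (constrEnum (Bj ν.M₁ Z k) k ⟨⟨j, Nat.lt_succ_of_le hj⟩, c, hc⟩)
  -- transport along `e.symm (e x) = x` (the index is a dependent pair, so we generalise before substituting)
  have key : ∀ y : ConstrSet (Bj ν.M₁ Z k) k, y = ⟨⟨j, Nat.lt_succ_of_le hj⟩, c, hc⟩ →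
      ContinuousOn (fun U : GaugeField (F.P K) 0 (SU N) =>
        ((avgFamily (avOfRecord F N K) U y.1 y.2.1 : SU N) : Matrix (Fin N) (Fin N) ℂ)) (closure (regMSCoPOfRecord F N ν K kc (maxDomT ν.M₁ Z))) →
      ContinuousOn (Subtype.val ∘ fun U : GaugeField (F.P K) 0 (SU N) => Averaging.iter (avOfRecord F N K) j U c)
        (closure (regMSCoPOfRecord F N ν K kc (maxDomT ν.M₁ Z))) := by
    rintro _ rfl h'
    exact h'
  exact Topology.IsInducing.subtypeVal.continuousOn_iff.2 (key _ (Equiv.symm_apply_apply _ _) hi)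

/-- ★★★ **[15] THEOREM 1, EXISTENCE HALF, CLOSED-CLASS READING, AT THE RECORD's `𝐁_k(Z)`**: for every multi-scale datum `W` whose (2.10) fibre `{Ū = W on 𝐁_k(Z)}` meets the closure
of NODE 00's (2.12) class, the Wilson action attains its minimum on that fibre within the closure — `∃ U₀, IsMinimizer (avOfRecord F N K) (closure (regMSCoPOfRecord …)) (Bj ν.M₁ Z k) W U₀` —
by dag-n07-e's direct method (compactness of `SU(N)^{bonds}`, closedness of the fibre from the continuity of the constrained averages) fed by Part 3.  Modulo numerics of print's type only.
[cite: Balaban1985Variational, Thm 1 p.279, (2), (6)–(7) pp.278–279; Balaban1988Convergent, (2.10)–(2.13) pp.256–257; Balaban1985Averaging, Prop. 2 (52)–(54) p.26] -/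
theorem exists_isMinimizer_closure_regMSCoPOfRecord_Bj (ν : Stage7Numerics) (hε : 0 < ν.εreg) {k : ℕ} (hk : k ≤ (F.P K).m + (F.P K).K)
    (hdiv : side (F.P K).L ν.M₁ k ∣ (F.P K).sitesPerDir 0) (hfloor : ((F.P K).d + 14) * (F.P K).L ≤ ν.M₁) (Z : Set (Site (F.P K) 0))
    (kc : ℕ) (hkc : k ≤ kc + 1)
    (hα3 : (143 * (((((F.P K).d + 4 : ℕ) : ℝ)) ^ 2 / 4) ^ 2) * (2 * ((F.P K).L : ℝ) ^ 2 * ν.εreg) ≤ 1 / 3)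
    (hα2 : 2 * (2 * ((F.P K).L : ℝ) ^ 2 * ν.εreg) ≤ 2 * deltaSU (Fin N) / ((((F.P K).d + 4) * (F.P K).L : ℕ) : ℝ) ^ 2)
    {W : MSField (F.P K) (SU N)}
    (hne : ∃ U ∈ closure (regMSCoPOfRecord F N ν K kc (maxDomT ν.M₁ Z)), AgreeOn (Bj ν.M₁ Z k) (avgFamily (avOfRecord F N K) U) W) :
    ∃ U₀ : GaugeField (F.P K) 0 (SU N), IsMinimizer (avOfRecord F N K) (closure (regMSCoPOfRecord F N ν K kc (maxDomT ν.M₁ Z))) (Bj ν.M₁ Z k) W U₀ :=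
  exists_isMinimizer_of_isClosed_of_continuousOn K k isClosed_closure (Bj ν.M₁ Z k) (fun _ hj => Bj_of_gt hj)
    (fun _ hj _ hb => continuousOn_iter_apply_closure_regMSCoPOfRecord_Bj ν hε hk hdiv hfloor Z kc hkc hα3 hα2 hj hb) hne

end Summit.QuantumFields.YangMills.BalabanUVNodes.N12MinimiserExistsClosedClassBj

end
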